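import Summits.CriticalPhenomena.PercolationContinuityZ3.Theorems.PercNearOneGluingNoHeavyLowerTailStarSetLedgerAbstract
import HarnessLib

/-!
# `NoHeavyLowerTail` (stmt-CriticalPhenomena-4575) — the class-level charging theorem reduced to a bound on the units (blueprint B7b core)

Support file (prover `prim-gen-swap` gen 13; `--supports stmt-CriticalPhenomena-4575`).  No definitions, no named facts, no sorries.

LEAN-BLUEPRINT-U1.md §C/§F7: the left side `Σ_S W(S)(n(S) − y(S))` of the class-level charging theorem (`charging_classLevel`, ChargingTargets) equals
`Σ_{units} W − Σ_{Cred} W`, where a UNIT is a pair `(S, X)` with `X` a CHARGED Ω-chord of `S`: all Ω-chords of `S` (chords avoiding `r` adjacent to every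
class of `S`) when `y(S) = 0`, all but the free one `free S ∈ Ω(S)` when `y(S) = 1` (U1-PROOF.md §2; the free rule itself is a parameter here), and
`Cred = {S : Ω(S) = ∅, y(S) = 1}`.  Hence the theorem follows from the UNIT BOUND `Σ_{units} W(S) ≤ Σ_{S ∈ Cred} W(S) + (class-word budget)`, which is
what the six families of the charging scheme establish.

* `StarSet.omegaCount_eq_card` — the `n(S)` indicator sum is `#Ω(S)`;
* `StarSet.yIndicator_eq` — the `y(S)` indicator sum is `[S ∩ F = ∅ ∨ the first open forest class is a child edge]`;
* `StarSet.charging_classLevel_of_units` — the reduction.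
-/

namespace Summit.CriticalPhenomena.PercolationContinuityZ3.Theorems

open Finset
open scoped BigOperators

namespace StarSet

variable {ι V : Type*} [Fintype ι] [LinearOrder ι] [DecidableEq V]

/-- The `n(S)` indicator sum of `config_expansion_identity` counts the Ω-chords of `S`. -/
theorem omegaCount_eq_card (P P' : ι → V) (Cr S : Finset ι) :
    (∑ κ ∈ Cr, (if (κ ∈ S ∧ ∀ j ∈ univ.filter (fun j => ¬ (P j = P κ ∨ P j = P' κ ∨ P' j = P κ ∨ P' j = P' κ)), j ∉ S)
        then (1 : ℝ) else 0)) =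
      ((S.filter (fun X => X ∈ Cr ∧ ∀ Y ∈ S, (P Y = P X ∨ P Y = P' X ∨ P' Y = P X ∨ P' Y = P' X))).card : ℝ) := by
  rw [sum_boole]
  congr 1
  congr 1
  ext κ
  simp only [mem_filter, mem_univ, true_and]
  constructor
  · rintro ⟨hκ, hS, hall⟩
    exact ⟨hS, hκ, fun Y hY => by by_contra h; exact hall Y h hY⟩
  · rintro ⟨hS, hκ, hall⟩
    exact ⟨hκ, hS, fun j hj hjS => hj (hall j hjS)⟩

/-- The `y(S)` indicator sum of `config_expansion_identity` is the indicator of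
"no forest class is open, or the first open forest class is a child edge". -/
theorem yIndicator_eq (P : ι → V) (r : V) (F S : Finset ι) :
    ((if (∀ I ∈ F, I ∉ S) then (1 : ℝ) else 0) +
        ∑ a ∈ F.filter (fun a => P a = r), (if (a ∈ S ∧ ∀ b ∈ F.filter (· < a), b ∉ S) then (1 : ℝ) else 0)) =
      if ((∀ I ∈ F, I ∉ S) ∨ ∃ a ∈ F, P a = r ∧ a ∈ S ∧ ∀ b ∈ F, b < a → b ∉ S) then (1 : ℝ) else 0 := by
  classical
  by_cases h0 : ∀ I ∈ F, I ∉ S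
  · rw [if_pos h0, if_pos (Or.inl h0)]
    have : ∑ a ∈ F.filter (fun a => P a = r), (if (a ∈ S ∧ ∀ b ∈ F.filter (· < a), b ∉ S) then (1 : ℝ) else 0) = 0 :=
      sum_eq_zero fun a ha => by rw [if_neg (fun h => h0 a (mem_filter.1 ha).1 h.1)]
    rw [this, add_zero]
  rw [if_neg h0, zero_add, sum_boole]
  by_cases h1 : ∃ a ∈ F, P a = r ∧ a ∈ S ∧ ∀ b ∈ F, b < a → b ∉ S
  · rw [if_pos (Or.inr h1)]
    obtain ⟨a, haF, har, haS, hmin⟩ := h1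
    have hfilt : (F.filter (fun a => P a = r)).filter (fun a => a ∈ S ∧ ∀ b ∈ F.filter (· < a), b ∉ S) = {a} := by
      ext a'
      simp only [mem_filter, mem_singleton]
      constructor
      · rintro ⟨⟨ha'F, -⟩, ha'S, hmin'⟩
        by_contra hne
        rcases lt_or_gt_of_ne hne with hlt | hlt
        · exact hmin a' ha'F hlt ha'S
        · exact hmin' a ⟨haF, hlt⟩ haS
      · rintro rfl
        exact ⟨⟨haF, har⟩, haS, fun b hb => hmin b hb.1 hb.2⟩
    rw [hfilt, card_singleton]; simp
  · rw [if_neg (not_or.2 ⟨h0, h1⟩)]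
    have hfilt : (F.filter (fun a => P a = r)).filter (fun a => a ∈ S ∧ ∀ b ∈ F.filter (· < a), b ∉ S) = ∅ := by
      ext a'
      simp only [mem_filter, Finset.notMem_empty, iff_false, not_and]
      intro ha' ha'S hmin'
      exact h1 ⟨a', ha'.1, ha'.2, ha'S, fun b hb hlt => hmin' b ⟨hb, hlt⟩⟩
    rw [hfilt, card_empty]; simp

/-- **Reduction of the class-level charging theorem to the unit bound (blueprint B7b).**  For ANY free rule `free S ∈ Ω(S)`, if the units
(pairs `(S, X)` with `X` a charged Ω-chord of `S`) have total weight at most the credit `Σ_{Cred} W` plus a budget `B`, then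
`Σ_S W(S)(n(S) − y(S)) ≤ B`. -/
theorem charging_classLevel_of_units (P P' : ι → V) (r : V) (F : Finset ι) (θ : ι → ℝ) (B : ℝ)
    (free : Finset ι → ι)
    (hfree : ∀ S : Finset ι, (S.filter (fun X => X ∈ (univ \ F).filter (fun κ => P κ ≠ r ∧ P' κ ≠ r) ∧
      ∀ Y ∈ S, (P Y = P X ∨ P Y = P' X ∨ P' Y = P X ∨ P' Y = P' X))).Nonempty →
      free S ∈ S.filter (fun X => X ∈ (univ \ F).filter (fun κ => P κ ≠ r ∧ P' κ ≠ r) ∧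
        ∀ Y ∈ S, (P Y = P X ∨ P Y = P' X ∨ P' Y = P X ∨ P' Y = P' X)))
    (hU : ∑ u ∈ (univ : Finset (Finset ι × ι)).filter (fun u => u.2 ∈
        (if ((∀ I ∈ F, I ∉ u.1) ∨ ∃ a ∈ F, P a = r ∧ a ∈ u.1 ∧ ∀ b ∈ F, b < a → b ∉ u.1) then
          (u.1.filter (fun X => X ∈ (univ \ F).filter (fun κ => P κ ≠ r ∧ P' κ ≠ r) ∧
            ∀ Y ∈ u.1, (P Y = P X ∨ P Y = P' X ∨ P' Y = P X ∨ P' Y = P' X))).erase (free u.1)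
         else
          u.1.filter (fun X => X ∈ (univ \ F).filter (fun κ => P κ ≠ r ∧ P' κ ≠ r) ∧
            ∀ Y ∈ u.1, (P Y = P X ∨ P Y = P' X ∨ P' Y = P X ∨ P' Y = P' X)))),
        ((∏ k ∈ u.1, θ k) * ∏ k ∈ univ \ u.1, (1 - θ k)) ≤
      ∑ S ∈ (univ : Finset ι).powerset.filter (fun S =>
          S.filter (fun X => X ∈ (univ \ F).filter (fun κ => P κ ≠ r ∧ P' κ ≠ r) ∧
            ∀ Y ∈ S, (P Y = P X ∨ P Y = P' X ∨ P' Y = P X ∨ P' Y = P' X)) = ∅ ∧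
          ((∀ I ∈ F, I ∉ S) ∨ ∃ a ∈ F, P a = r ∧ a ∈ S ∧ ∀ b ∈ F, b < a → b ∉ S)),
        ((∏ k ∈ S, θ k) * ∏ k ∈ univ \ S, (1 - θ k)) + B) :
    ∑ S ∈ (univ : Finset ι).powerset, ((∏ k ∈ S, θ k) * ∏ k ∈ univ \ S, (1 - θ k)) *
        ((∑ κ ∈ (univ \ F).filter (fun κ => P κ ≠ r ∧ P' κ ≠ r),
            (if (κ ∈ S ∧ ∀ j ∈ univ.filter (fun j => ¬ (P j = P κ ∨ P j = P' κ ∨ P' j = P κ ∨ P' j = P' κ)), j ∉ S)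
              then (1 : ℝ) else 0)) -
          ((if (∀ I ∈ F, I ∉ S) then (1 : ℝ) else 0) +
            ∑ a ∈ F.filter (fun a => P a = r), (if (a ∈ S ∧ ∀ b ∈ F.filter (· < a), b ∉ S) then (1 : ℝ) else 0))) ≤ B := by
  classical
  set W : Finset ι → ℝ := fun S => (∏ k ∈ S, θ k) * ∏ k ∈ univ \ S, (1 - θ k) with hW
  set Cr := (univ \ F).filter (fun κ => P κ ≠ r ∧ P' κ ≠ r) with hCr
  set Ω : Finset ι → Finset ι := fun S => S.filter (fun X => X ∈ Cr ∧
    ∀ Y ∈ S, (P Y = P X ∨ P Y = P' X ∨ P' Y = P X ∨ P' Y = P' X)) with hΩ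
  set y1 : Finset ι → Prop := fun S => (∀ I ∈ F, I ∉ S) ∨ ∃ a ∈ F, P a = r ∧ a ∈ S ∧ ∀ b ∈ F, b < a → b ∉ S with hy1
  set charged : Finset ι → Finset ι := fun S => if y1 S then (Ω S).erase (free S) else Ω S with hcharged
  -- integer-valued `n` and `y`
  set nN : Finset ι → ℕ := fun S => (Ω S).card with hnN
  set yN : Finset ι → ℕ := fun S => if y1 S then 1 else 0 with hyN
  have hsummand : ∀ S ∈ (univ : Finset ι).powerset,
      W S * ((∑ κ ∈ Cr, (if (κ ∈ S ∧ ∀ j ∈ univ.filter (fun j => ¬ (P j = P κ ∨ P j = P' κ ∨ P' j = P κ ∨ P' j = P' κ)), j ∉ S)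
          then (1 : ℝ) else 0)) -
        ((if (∀ I ∈ F, I ∉ S) then (1 : ℝ) else 0) +
          ∑ a ∈ F.filter (fun a => P a = r), (if (a ∈ S ∧ ∀ b ∈ F.filter (· < a), b ∉ S) then (1 : ℝ) else 0))) =
      W S * ((nN S : ℝ) - (yN S : ℝ)) := by
    intro S _
    rw [omegaCount_eq_card P P' Cr S, yIndicator_eq P r F S]
    simp only [hnN, hyN, hΩ, hy1]
    congr 2
    split_ifs <;> simp
  rw [sum_congr rfl hsummand, config_sum_posPart_sub_cred _ W nN yN (fun S _ => by simp only [hyN]; split_ifs <;> simp)]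
  -- the charged count
  have hcard : ∀ S : Finset ι, (charged S).card = nN S - yN S := by
    intro S
    simp only [hcharged, hnN, hyN]
    by_cases hy : y1 S
    · rw [if_pos hy, if_pos hy]
      by_cases hne : (Ω S).Nonempty
      · rw [card_erase_of_mem (hfree S hne)]
      · rw [not_nonempty_iff_eq_empty.1 hne]; simp
    · rw [if_neg hy, if_neg hy]; simp
  -- units as pairs
  have hunits : ∑ u ∈ (univ : Finset (Finset ι × ι)).filter (fun u => u.2 ∈ charged u.1), W u.1 =
      ∑ S ∈ (univ : Finset ι).powerset, W S * ((nN S - yN S : ℕ) : ℝ) := by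
    rw [sum_filter, ← Finset.univ_product_univ, sum_product, Finset.powerset_univ]
    refine sum_congr rfl fun S _ => ?_
    dsimp only
    rw [← sum_filter, sum_const, nsmul_eq_mul, filter_mem_eq_inter, univ_inter, hcard S, mul_comm]
  -- the credit sum
  have hcred : ∑ S ∈ (univ : Finset ι).powerset.filter (fun S => nN S = 0 ∧ yN S = 1), W S =
      ∑ S ∈ (univ : Finset ι).powerset.filter (fun S => Ω S = ∅ ∧ y1 S), W S := by
    refine sum_congr (filter_congr fun S _ => ?_) fun _ _ => rfl
    simp only [hnN, hyN, card_eq_zero]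
    constructor
    · rintro ⟨h1, h2⟩
      refine ⟨h1, ?_⟩
      by_contra h; rw [if_neg h] at h2; exact absurd h2 (by norm_num)
    · rintro ⟨h1, h2⟩; exact ⟨h1, by rw [if_pos h2]⟩
  rw [← hunits, hcred]
  simp only [hW, hΩ, hy1, hcharged, hCr] at hU ⊢
  linarith [hU]

end StarSet

end Summit.CriticalPhenomena.PercolationContinuityZ3.Theorems
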